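import Summits.ResolutionOfSingularities.ResolutionOfSingularities.Theorems.EquisingularLiftEquisingularLiftNatNDTransportInit
import Summits.ResolutionOfSingularities.ResolutionOfSingularities.Theorems.EquisingularLiftEquisingularLiftNatNDRoundPropsP
import HarnessLib

/-!
# (B4β0₀) `transportInit₀ : ND.TransportInit₀ n k` — the (L-β0) re-land of (B4β0) ✓ p644379 `ND.transportInit` against the LOCALISED round layer

[OURS · L1 W4.5b · EL♮(3) stmt-ResolutionOfSingularities-20148 · desk RULING R36 (K-reg) = (i) LOCALISE, L0 «delete the ambient-regularity binder», WIDTH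
TABLE D2 «K-LOC» hand (L-β0) = res-L1-w45b-stub-2 g15; NAMES FINAL 2026-08-28T16:40:01Z] — NOT a statement of the manuscript [Hironaka2017]; counted 0; AI kernel
work weaker than expert review.  Closes BY NAME the Prop `ND.TransportInit₀ n k` of res-L1-w45b-lead-2's port `…NatNDRoundPropsP` (✓ p649163; = SPEC K6-loc v2
§L0, res-L1-w45b-idea-1: the tree's `ND.TransportInit` ✓ p643982 with the binder `Scheme.IsRegular F₁ →` DELETED).  The landed proof of ✓ p644379 never used that
binder (`_hreg`, its docstring says so), so the proof below is ✓ p644379's `transportInit` with the binder removed from the `intro` line and NOTHING else changed: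
`FStage` of the point blow-up (`isIso_morphismRestrict_pointStep`, `closure_preimage_diff_inter`, `support_stepAlong_frameBoundary_subset`) and the first link
`exists_linked_init` — all imported from ✓ p644379's module, not restated.  DEF-FREE; no `sorry`; standard axioms.  Consumer: lead-2's K6 closing kit (L-Ω)
(`ND.ndInvLNP_round` over the four `₀` bricks) = the 38th registration's theorem (desk R35/R36).
-/

set_option linter.dupNamespace false -- mandated namespace `Summit.<Summit>.<Problem>` of this single-conjunct summit

noncomputable section

open CategoryTheory CategoryTheory.Limits AlgebraicGeometry TopologicalSpace Topology IsLocalRing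
open Literature.AlgebraicGeometry.Resolution
open AlgebraicGeometry.Scheme.IdealSheafData

namespace Summit.ResolutionOfSingularities.ResolutionOfSingularities.Cruxes.EquisingularLiftNat.Sections.ND

/-- **(B4β0₀) `transportInit₀`** — the point blow-up of `x` and any blow-up of the origin of `𝔸ⁿ_k` give the first F-stage and the first LINK over
`Spec 𝒪_{F₁,x}`; = ✓ p644379 `transportInit` against `TransportInit₀` (the unused ambient-regularity binder deleted; proof byte-identical otherwise).
Unused hypotheses of the Prop (honest): `LocalNDWon g`, `IsAlgClosed k`. [OURS · L1 W4.5b · (L-β0)] -/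
theorem transportInit₀ (n : ℕ) (k : Type) [Field k] [IsAlgClosed k] : TransportInit₀ n k := by
  intro F₁ ρ T₁ hLN hT₁ x hx W w g h1 h2 h3 _h4 h5 F₂ υ hυ A₂ π₀ hπ₀
  haveI := hLN
  haveI : IsProper υ := hυ.isProper
  refine ⟨⟨LocallyOfFiniteType.isLocallyNoetherian υ, isIso_morphismRestrict_pointStep hx hυ, closure_preimage_diff_inter T₁ hT₁ υ,
    isClosed_closure, fun ρ' hρ' => support_stepAlong_frameBoundary_subset hx W hρ'⟩, ?_⟩
  exact exists_linked_init n k ρ hx T₁ hT₁ W w g h1 h2 h3 h5 hυ hπ₀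

end Summit.ResolutionOfSingularities.ResolutionOfSingularities.Cruxes.EquisingularLiftNat.Sections.ND

end
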